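import Summits.ResolutionOfSingularities.ResolutionOfSingularities.Theses.IndSmooth
import Summits.ResolutionOfSingularities.ResolutionOfSingularities.Theorems.IndSmoothSmoothToUniformizingLocalChart
import Summits.ResolutionOfSingularities.ResolutionOfSingularities.Theorems.IndSmoothSmoothToUniformizingSliceChart
import Summits.ResolutionOfSingularities.ResolutionOfSingularities.Theorems.IndSmoothSmoothToUniformizingModelOfInjectiveChart
import Summits.ResolutionOfSingularities.ResolutionOfSingularities.Theorems.IndSmoothSmoothToUniformizingRetractRegular
import Literature.AlgebraicGeometry.Resolution.ArithmeticalThreefolds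
import HarnessLib

/-!
# Crux `SmoothToUniformizing` (stmt-ResolutionOfSingularities-16088) — line `birth`, skeleton v6
# (continuation lead c1: the CHART CALCULUS reshape; v6 = v5 with the four TRUE stubs CLOSED)

Route `ResolutionOfSingularities/IndSmooth`, crux #3 (rank 3, the INJECTIVITY UPGRADE):
`SmoothToUniformizing` = "for every prime `p`: if every valuation ring `O ⊇ k` of every finitely
generated field `K` over every perfect field `k` of characteristic `p` is ind-smooth (every finitely
generated `R ⊆ O` factors `R → T → O` through a smooth `k`-algebra `T`), then relative local
uniformization holds at `p` (some finitely generated `A` with `R ≤ A ⊆ O`, `Frac A = K`, `A` regular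
at the centre `𝔪_O ∩ A`)".

## v5/v6 — what changed and why

v6 (this file): the four TRUE stubs of v5 are CLOSED by the landed worker files p162332
(`stub_localChart`), p162087 (`stub_sliceChart`), p162285 (`stub_modelOfInjectiveChart`), p162129
(`stub_retractRegular`); ONE `sorry` remains = the kernel `stub_stuckTowerStabilises`.

Seat 0 drove v1–v4 (cut at Néron's smoothness measure) to `promote-stub stub_flatKaehlerLevel`:
that stub is the crux itself (kernel-certified, p154441), with no structure in hand. v5 re-cuts the
crux along the two idea cards on file (`slice-the-chart`, `Ideas/rational-place-descent.md`) and the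
planner's foreseen split (TowerStabilises → RetractRegular), so that everything TRUE about smooth
charts is a registered stub of worker size and the single open stub is the honest kernel:

* A **local regular chart** of `R ⊆ O ⊆ K` is a regular local `k`-algebra `L`, essentially of
  finite type, with `k`-algebra maps `ψ : R → L`, `χ : L → K` such that `χ(L) ⊆ O`,
  `χ⁻¹(𝔪_O) = 𝔪_L` and `χ ∘ ψ = ` the inclusion (spelled out in every signature; no local
  definition enters a registered statement).
* `stub_localChart` (TRUE): a smooth chart `R → T → O` localizes at `χ⁻¹(𝔪_O)` to a local regular
  chart (smooth ⇒ regular, EGA IV 17.5.8).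
* `stub_sliceChart` (TRUE): if `g ∈ ker χ ∖ 𝔪_L²` then `L/(g)` is again a local regular chart of
  `R`, of embedding dimension one less (Matsumura 14.2).
* `injective_or_stuck` (PROVED HERE from `stub_sliceChart`, induction on the embedding dimension):
  every local regular chart of `R` refines to one which is INJECTIVE or STUCK
  (`0 ≠ ker χ ⊆ 𝔪_L²`).
* `stub_modelOfInjectiveChart` (TRUE): an injective local regular chart of `R` (with
  `Frac R = K`) is the local ring of a MODEL: some finitely generated `A ⊆ O`, `R ≤ A`,
  `Frac A = K`, `A` regular at the centre.
* `stub_stuckTowerStabilises` (OPEN — the kernel of the crux): given ind-smoothness at `p` and a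
  STUCK local regular chart of `R`, some finitely generated level `R ≤ B ⊆ O` carries a smooth
  chart RETRACTING onto `B` (`χ'(T') ⊆ B`): "the tower of images stabilises".
* `stub_retractRegular` (TRUE): a finitely generated `B ⊆ O` which is a `k`-algebra retract of a
  smooth `k`-algebra is regular at the centre (a retract of a formally smooth algebra is formally
  smooth; smooth ⇒ regular).

`SmoothToUniformizing_of` assembles: enlarge `R` by an affine model of `K` in `O`
(`exists_affineModel`), take the smooth chart given by ind-smoothness, localize, run the
dichotomy; an injective chart is a model, a stuck chart is handed to the kernel and then to
`stub_retractRegular`.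

Disproof used (`Cruxes/SmoothToUniformizing/Disproof.lean`, cdisprove v1–v2): §2 `hO` redundant /
`p.Prime` decorative / `Algebra.Smooth` is the lever (`withoutSmooth_iff_lurelPerfect`) — respected:
the kernel keeps the full ind-smoothness antecedent as a hypothesis; §3 `O = K` degenerate TRUE —
the dichotomy's injective branch covers it; §4b `stub_valuativeJacobian_false_without_flat` concerns
the retired v1–v4 cut only.
-/

noncomputable section

-- single-problem summit: the doubled namespace component `ResolutionOfSingularities` is forced
set_option linter.dupNamespace false

open Summit.ResolutionOfSingularities.ResolutionOfSingularities.Theses.IndSmooth (SmoothToUniformizing)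
open Literature.AlgebraicGeometry.Resolution (exists_affineModel isFractionRing_of_le)
open IsLocalRing

namespace Summit.ResolutionOfSingularities.ResolutionOfSingularities.Cruxes.SmoothToUniformizing.Lines.Birth

/-! ## Reading abbreviations (NOT used in the stub signatures) -/

/-- **Ind-smoothness at `p`** — verbatim the antecedent of the crux at the prime `p`.
[cite: AntieauDatta2021, Prop. 27] -/
def IndSmoothAt (p : ℕ) : Prop :=
  ∀ (k K : Type) [Field k] [CharP k p] [PerfectField k] [Field K] [Algebra k K],
    (⊤ : IntermediateField k K).FG → ∀ O : ValuationSubring K, (∀ c : k, algebraMap k K c ∈ O) →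
    ∀ R : Subalgebra k K, R.FG → R.toSubring ≤ O.toSubring →
    ∃ (T : Type) (_ : CommRing T) (_ : Algebra k T), Algebra.Smooth k T ∧
      ∃ (ψ : R →ₐ[k] T) (χ : T →ₐ[k] K), (∀ t : T, χ t ∈ O) ∧ ∀ r : R, χ (ψ r) = (r : K)

/-- **Relative local uniformization at `p`** — verbatim the consequent of the crux at `p`.
[cite: Temkin2013, §1.3] -/
def LurelAt (p : ℕ) : Prop :=
  ∀ (k K : Type) [Field k] [CharP k p] [PerfectField k] [Field K] [Algebra k K],
    (⊤ : IntermediateField k K).FG → ∀ O : ValuationSubring K, (∀ c : k, algebraMap k K c ∈ O) →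
    ∀ R : Subalgebra k K, R.FG → R.toSubring ≤ O.toSubring →
    ∃ (A : Subalgebra k K) (h : A.toSubring ≤ O.toSubring), R ≤ A ∧ A.FG ∧ IsFractionRing A K ∧
      IsRegularLocalRing (Localization.AtPrime
        (Ideal.comap (Subring.inclusion h) (IsLocalRing.maximalIdeal O)))

/-- Unfolding: the crux is `∀ p prime, IndSmoothAt p → LurelAt p` on the nose. [folklore] -/
theorem smoothToUniformizing_iff :
    SmoothToUniformizing ↔ ∀ p : ℕ, p.Prime → IndSmoothAt p → LurelAt p :=
  Iff.rfl

section Charts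

variable {k K : Type} [Field k] [Field K] [Algebra k K]

/-- **Local regular chart** of `R ⊆ O ⊆ K` on the regular local `k`-algebra `L` (reading
abbreviation for the conjunction spelled out in every stub): `χ(L) ⊆ O`, `χ⁻¹(𝔪_O) = 𝔪_L`,
`χ ∘ ψ =` the inclusion. [folklore] -/
def IsLocalChart (O : ValuationSubring K) (R : Subalgebra k K) (L : Type) [CommRing L]
    [IsLocalRing L] [Algebra k L] (ψ : R →ₐ[k] L) (χ : L →ₐ[k] K) : Prop :=
  (∀ x : L, χ x ∈ O) ∧ (∀ x : L, x ∈ maximalIdeal L ↔ O.valuation (χ x) < 1) ∧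
    ∀ r : R, χ (ψ r) = (r : K)

/-- A local chart is **stuck** when its kernel is non-zero and lies in `𝔪_L²`. [folklore] -/
def IsStuck (L : Type) [CommRing L] [IsLocalRing L] [Algebra k L] (χ : L →ₐ[k] K) : Prop :=
  RingHom.ker χ ≠ ⊥ ∧ ∀ g : L, χ g = 0 → g ∈ (maximalIdeal L) ^ 2

end Charts

/-! ## The stub STATEMENTS by name (pure Mathlib vocabulary) -/

/-- Statement of `stub_localChart`. [cite: GortzWedhorn2020, Lemma 6.26] -/
def Sig.stub_localChart : Prop :=
  ∀ (k K : Type) [Field k] [Field K] [Algebra k K] (O : ValuationSubring K) (R : Subalgebra k K)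
    (T : Type) [CommRing T] [Algebra k T] [Algebra.Smooth k T] (ψ : R →ₐ[k] T) (χ : T →ₐ[k] K),
    (∀ t : T, χ t ∈ O) → (∀ r : R, χ (ψ r) = (r : K)) →
    ∃ (L : Type) (_ : CommRing L) (_ : IsRegularLocalRing L) (_ : Algebra k L)
      (_ : Algebra.EssFiniteType k L) (ψ' : R →ₐ[k] L) (χ' : L →ₐ[k] K),
      (∀ x : L, χ' x ∈ O) ∧ (∀ x : L, x ∈ maximalIdeal L ↔ O.valuation (χ' x) < 1) ∧
        ∀ r : R, χ' (ψ' r) = (r : K)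

/-- Statement of `stub_sliceChart`. [cite: Matsumura1987, Thm. 14.2] -/
def Sig.stub_sliceChart : Prop :=
  ∀ (k K : Type) [Field k] [Field K] [Algebra k K] (O : ValuationSubring K) (R : Subalgebra k K)
    (L : Type) [CommRing L] [IsRegularLocalRing L] [Algebra k L] [Algebra.EssFiniteType k L]
    (ψ : R →ₐ[k] L) (χ : L →ₐ[k] K),
    (∀ x : L, χ x ∈ O) → (∀ x : L, x ∈ maximalIdeal L ↔ O.valuation (χ x) < 1) →
    (∀ r : R, χ (ψ r) = (r : K)) →
    ∀ g : L, χ g = 0 → g ∉ (maximalIdeal L) ^ 2 →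
    ∃ (L' : Type) (_ : CommRing L') (_ : IsRegularLocalRing L') (_ : Algebra k L')
      (_ : Algebra.EssFiniteType k L') (ψ' : R →ₐ[k] L') (χ' : L' →ₐ[k] K),
      (∀ x : L', χ' x ∈ O) ∧ (∀ x : L', x ∈ maximalIdeal L' ↔ O.valuation (χ' x) < 1) ∧
        (∀ r : R, χ' (ψ' r) = (r : K)) ∧
        (maximalIdeal L').spanFinrank + 1 = (maximalIdeal L).spanFinrank

/-- Statement of `stub_modelOfInjectiveChart`. [cite: GortzWedhorn2020, Lemma 6.26] -/
def Sig.stub_modelOfInjectiveChart : Prop :=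
  ∀ (k K : Type) [Field k] [Field K] [Algebra k K] (O : ValuationSubring K) (R : Subalgebra k K),
    R.FG → R.toSubring ≤ O.toSubring → IsFractionRing R K →
    ∀ (L : Type) [CommRing L] [IsRegularLocalRing L] [Algebra k L] [Algebra.EssFiniteType k L]
      (ψ : R →ₐ[k] L) (χ : L →ₐ[k] K),
      (∀ x : L, χ x ∈ O) → (∀ x : L, x ∈ maximalIdeal L ↔ O.valuation (χ x) < 1) →
      (∀ r : R, χ (ψ r) = (r : K)) → Function.Injective χ →
      ∃ (A : Subalgebra k K) (h : A.toSubring ≤ O.toSubring), R ≤ A ∧ A.FG ∧ IsFractionRing A K ∧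
        IsRegularLocalRing (Localization.AtPrime
          (Ideal.comap (Subring.inclusion h) (IsLocalRing.maximalIdeal O)))

/-- Statement of `stub_stuckTowerStabilises` (the kernel). [cite: AntieauDatta2021, Prop. 27] -/
def Sig.stub_stuckTowerStabilises : Prop :=
  ∀ p : ℕ, p.Prime →
    (∀ (k K : Type) [Field k] [CharP k p] [PerfectField k] [Field K] [Algebra k K],
      (⊤ : IntermediateField k K).FG → ∀ O : ValuationSubring K, (∀ c : k, algebraMap k K c ∈ O) →
      ∀ R : Subalgebra k K, R.FG → R.toSubring ≤ O.toSubring →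
      ∃ (T : Type) (_ : CommRing T) (_ : Algebra k T), Algebra.Smooth k T ∧
        ∃ (ψ : R →ₐ[k] T) (χ : T →ₐ[k] K), (∀ t : T, χ t ∈ O) ∧ ∀ r : R, χ (ψ r) = (r : K)) →
    ∀ (k K : Type) [Field k] [CharP k p] [PerfectField k] [Field K] [Algebra k K],
      (⊤ : IntermediateField k K).FG → ∀ O : ValuationSubring K, (∀ c : k, algebraMap k K c ∈ O) →
      ∀ R : Subalgebra k K, R.FG → R.toSubring ≤ O.toSubring → IsFractionRing R K →
      ∀ (L : Type) [CommRing L] [IsRegularLocalRing L] [Algebra k L] [Algebra.EssFiniteType k L]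
        (ψ : R →ₐ[k] L) (χ : L →ₐ[k] K),
        (∀ x : L, χ x ∈ O) → (∀ x : L, x ∈ maximalIdeal L ↔ O.valuation (χ x) < 1) →
        (∀ r : R, χ (ψ r) = (r : K)) →
        RingHom.ker χ ≠ ⊥ → (∀ g : L, χ g = 0 → g ∈ (maximalIdeal L) ^ 2) →
        ∃ (B : Subalgebra k K) (_ : B.toSubring ≤ O.toSubring), R ≤ B ∧ B.FG ∧
          ∃ (T : Type) (_ : CommRing T) (_ : Algebra k T), Algebra.Smooth k T ∧
            ∃ (ψ' : B →ₐ[k] T) (χ' : T →ₐ[k] K),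
              (∀ b : B, χ' (ψ' b) = (b : K)) ∧ ∀ t : T, χ' t ∈ B

/-- Statement of `stub_retractRegular`. [cite: StacksProject, Tag 07GC] -/
def Sig.stub_retractRegular : Prop :=
  ∀ (k K : Type) [Field k] [Field K] [Algebra k K] (O : ValuationSubring K) (B : Subalgebra k K)
    (h : B.toSubring ≤ O.toSubring), B.FG →
    ∀ (T : Type) [CommRing T] [Algebra k T] [Algebra.Smooth k T] (ψ : B →ₐ[k] T) (χ : T →ₐ[k] K),
      (∀ b : B, χ (ψ b) = (b : K)) → (∀ t : T, χ t ∈ B) →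
      IsRegularLocalRing (Localization.AtPrime
        (Ideal.comap (Subring.inclusion h) (IsLocalRing.maximalIdeal O)))

/-! ## The stubs -/

/-- **STUB `stub_localChart` — CLOSED (p162332, `Theorems/IndSmoothSmoothToUniformizingLocalChart.lean`).** A smooth chart `R → T → O` gives a local regular chart:
localize `T` at the prime `𝔮 = χ⁻¹(𝔪_O)`; `T_𝔮` is regular (smooth over a field ⇒ regular,
EGA IV 17.5.8 (iii)), essentially of finite type, `χ` extends (`T ∖ 𝔮` maps to units of `O`),
and `χ⁻¹(𝔪_O) = 𝔮 T_𝔮`. [cite: GortzWedhorn2020, Lemma 6.26] -/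
theorem stub_localChart (k K : Type) [Field k] [Field K] [Algebra k K] (O : ValuationSubring K)
    (R : Subalgebra k K) (T : Type) [CommRing T] [Algebra k T] [Algebra.Smooth k T]
    (ψ : R →ₐ[k] T) (χ : T →ₐ[k] K) (hχO : ∀ t : T, χ t ∈ O)
    (hψχ : ∀ r : R, χ (ψ r) = (r : K)) :
    ∃ (L : Type) (_ : CommRing L) (_ : IsRegularLocalRing L) (_ : Algebra k L)
      (_ : Algebra.EssFiniteType k L) (ψ' : R →ₐ[k] L) (χ' : L →ₐ[k] K),
      (∀ x : L, χ' x ∈ O) ∧ (∀ x : L, x ∈ maximalIdeal L ↔ O.valuation (χ' x) < 1) ∧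
        ∀ r : R, χ' (ψ' r) = (r : K) :=
  Theorems.IndSmoothBirth.stub_localChart k K O R T ψ χ hχO hψχ

/-- **STUB `stub_sliceChart` — CLOSED (p162087, `Theorems/IndSmoothSmoothToUniformizingSliceChart.lean`).** Slicing a local regular chart by a kernel element outside
`𝔪_L²`: `L' = L/(g)` is regular of dimension one less (Matsumura 14.2), essentially of finite
type, `χ` factors through it (as `χ g = 0`), `ψ` composes, and `χ'⁻¹(𝔪_O) = 𝔪_{L'} = 𝔪_L/(g)`;
the embedding dimension drops by exactly one. [cite: Matsumura1987, Thm. 14.2] -/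
theorem stub_sliceChart (k K : Type) [Field k] [Field K] [Algebra k K] (O : ValuationSubring K)
    (R : Subalgebra k K) (L : Type) [CommRing L] [IsRegularLocalRing L] [Algebra k L]
    [Algebra.EssFiniteType k L] (ψ : R →ₐ[k] L) (χ : L →ₐ[k] K) (hχO : ∀ x : L, χ x ∈ O)
    (hloc : ∀ x : L, x ∈ maximalIdeal L ↔ O.valuation (χ x) < 1)
    (hψχ : ∀ r : R, χ (ψ r) = (r : K)) (g : L) (hg : χ g = 0)
    (hg2 : g ∉ (maximalIdeal L) ^ 2) :
    ∃ (L' : Type) (_ : CommRing L') (_ : IsRegularLocalRing L') (_ : Algebra k L')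
      (_ : Algebra.EssFiniteType k L') (ψ' : R →ₐ[k] L') (χ' : L' →ₐ[k] K),
      (∀ x : L', χ' x ∈ O) ∧ (∀ x : L', x ∈ maximalIdeal L' ↔ O.valuation (χ' x) < 1) ∧
        (∀ r : R, χ' (ψ' r) = (r : K)) ∧
        (maximalIdeal L').spanFinrank + 1 = (maximalIdeal L).spanFinrank :=
  Theorems.IndSmoothBirth.stub_sliceChart k K O R L ψ χ hχO hloc hψχ g hg hg2

/-- **STUB `stub_modelOfInjectiveChart` — CLOSED (p162285, `Theorems/IndSmoothSmoothToUniformizingModelOfInjectiveChart.lean`).** An injective local regular chart is the local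
ring of a model: write `L` as the localization of a finitely generated `k`-subalgebra `S ∋ ψ(R)`
at `S ∖ 𝔪_L`; then `A := χ(S) ≅ S` is finitely generated, `R ≤ A ⊆ O`, `Frac A = K` (as
`Frac R = K`), and `A` localized at the centre `χ(S) ∩ 𝔪_O ↔ S ∩ 𝔪_L` is `≅ L`, regular.
[cite: GortzWedhorn2020, Lemma 6.26] -/
theorem stub_modelOfInjectiveChart (k K : Type) [Field k] [Field K] [Algebra k K]
    (O : ValuationSubring K) (R : Subalgebra k K) (hR : R.FG) (hRO : R.toSubring ≤ O.toSubring)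
    (hRfr : IsFractionRing R K) (L : Type) [CommRing L] [IsRegularLocalRing L] [Algebra k L]
    [Algebra.EssFiniteType k L] (ψ : R →ₐ[k] L) (χ : L →ₐ[k] K) (hχO : ∀ x : L, χ x ∈ O)
    (hloc : ∀ x : L, x ∈ maximalIdeal L ↔ O.valuation (χ x) < 1)
    (hψχ : ∀ r : R, χ (ψ r) = (r : K)) (hinj : Function.Injective χ) :
    ∃ (A : Subalgebra k K) (h : A.toSubring ≤ O.toSubring), R ≤ A ∧ A.FG ∧ IsFractionRing A K ∧
      IsRegularLocalRing (Localization.AtPrime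
        (Ideal.comap (Subring.inclusion h) (IsLocalRing.maximalIdeal O))) :=
  Theorems.IndSmoothBirth.stub_modelOfInjectiveChart k K O R hR hRO hRfr L ψ χ hχO hloc hψχ hinj

/-- **STUB `stub_stuckTowerStabilises` (OPEN — the kernel of the crux).** Given ind-smoothness
at `p` (the crux's antecedent, re-applicable to any valuation ring of any function field over any
perfect field of characteristic `p`) and a STUCK local regular chart of `R` (`Frac R = K`,
`0 ≠ ker χ ⊆ 𝔪_L²`), some finitely generated level `R ≤ B ⊆ O` carries a smooth chart
retracting onto `B`. This is where local uniformization lives: `B` is then smooth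
(`stub_retractRegular`), and conversely a model `A` regular at the centre yields such a level
(`B = A_f` smooth, chart `T' = B`). [cite: AntieauDatta2021, Prop. 27] -/
theorem stub_stuckTowerStabilises (p : ℕ) (hp : p.Prime)
    (hind : ∀ (k K : Type) [Field k] [CharP k p] [PerfectField k] [Field K] [Algebra k K],
      (⊤ : IntermediateField k K).FG → ∀ O : ValuationSubring K, (∀ c : k, algebraMap k K c ∈ O) →
      ∀ R : Subalgebra k K, R.FG → R.toSubring ≤ O.toSubring →
      ∃ (T : Type) (_ : CommRing T) (_ : Algebra k T), Algebra.Smooth k T ∧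
        ∃ (ψ : R →ₐ[k] T) (χ : T →ₐ[k] K), (∀ t : T, χ t ∈ O) ∧ ∀ r : R, χ (ψ r) = (r : K))
    (k K : Type) [Field k] [CharP k p] [PerfectField k] [Field K] [Algebra k K]
    (hK : (⊤ : IntermediateField k K).FG) (O : ValuationSubring K)
    (hO : ∀ c : k, algebraMap k K c ∈ O) (R : Subalgebra k K) (hR : R.FG)
    (hRO : R.toSubring ≤ O.toSubring) (hRfr : IsFractionRing R K)
    (L : Type) [CommRing L] [IsRegularLocalRing L] [Algebra k L] [Algebra.EssFiniteType k L]
    (ψ : R →ₐ[k] L) (χ : L →ₐ[k] K) (hχO : ∀ x : L, χ x ∈ O)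
    (hloc : ∀ x : L, x ∈ maximalIdeal L ↔ O.valuation (χ x) < 1)
    (hψχ : ∀ r : R, χ (ψ r) = (r : K))
    (hker : RingHom.ker χ ≠ ⊥) (hstuck : ∀ g : L, χ g = 0 → g ∈ (maximalIdeal L) ^ 2) :
    ∃ (B : Subalgebra k K) (_ : B.toSubring ≤ O.toSubring), R ≤ B ∧ B.FG ∧
      ∃ (T : Type) (_ : CommRing T) (_ : Algebra k T), Algebra.Smooth k T ∧
        ∃ (ψ' : B →ₐ[k] T) (χ' : T →ₐ[k] K),
          (∀ b : B, χ' (ψ' b) = (b : K)) ∧ ∀ t : T, χ' t ∈ B := by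
  sorry

/-- **STUB `stub_retractRegular` — CLOSED (p162129, `Theorems/IndSmoothSmoothToUniformizingRetractRegular.lean`).** A finitely generated `B ⊆ O` which is a `k`-algebra
retract of a smooth `k`-algebra `T` (`B → T → B` the identity) is regular at the centre of `O`:
a retract of a formally smooth algebra is formally smooth (lift through `T`), `B` is finitely
presented, hence smooth over `k`, hence regular at every prime. [cite: StacksProject, Tag 07GC] -/
theorem stub_retractRegular (k K : Type) [Field k] [Field K] [Algebra k K] (O : ValuationSubring K)
    (B : Subalgebra k K) (h : B.toSubring ≤ O.toSubring) (hB : B.FG)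
    (T : Type) [CommRing T] [Algebra k T] [Algebra.Smooth k T] (ψ : B →ₐ[k] T) (χ : T →ₐ[k] K)
    (hψχ : ∀ b : B, χ (ψ b) = (b : K)) (hrange : ∀ t : T, χ t ∈ B) :
    IsRegularLocalRing (Localization.AtPrime
      (Ideal.comap (Subring.inclusion h) (IsLocalRing.maximalIdeal O))) :=
  Theorems.IndSmoothBirth.stub_retractRegular k K O B h hB T ψ χ hψχ hrange

/-! ## Proved here: the dichotomy (induction on the embedding dimension) -/

/-- **Every local regular chart refines to an injective or a stuck one** (same `k, K, O, R`):
if `ker χ = 0` we are done; if some `g ∈ ker χ` lies outside `𝔪_L²`, slice (the embedding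
dimension drops, `stub_sliceChart`); otherwise the chart is stuck. Induction on
`(𝔪_L).spanFinrank`. [folklore] -/
theorem injective_or_stuck (hslice : Sig.stub_sliceChart) {k K : Type} [Field k] [Field K]
    [Algebra k K] (O : ValuationSubring K) (R : Subalgebra k K) :
    ∀ (n : ℕ) (L : Type) [CommRing L] [IsRegularLocalRing L] [Algebra k L]
      [Algebra.EssFiniteType k L] (ψ : R →ₐ[k] L) (χ : L →ₐ[k] K),
      (∀ x : L, χ x ∈ O) → (∀ x : L, x ∈ maximalIdeal L ↔ O.valuation (χ x) < 1) →
      (∀ r : R, χ (ψ r) = (r : K)) → (maximalIdeal L).spanFinrank ≤ n →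
      ∃ (L' : Type) (_ : CommRing L') (_ : IsRegularLocalRing L') (_ : Algebra k L')
        (_ : Algebra.EssFiniteType k L') (ψ' : R →ₐ[k] L') (χ' : L' →ₐ[k] K),
        (∀ x : L', χ' x ∈ O) ∧ (∀ x : L', x ∈ maximalIdeal L' ↔ O.valuation (χ' x) < 1) ∧
          (∀ r : R, χ' (ψ' r) = (r : K)) ∧
          (Function.Injective χ' ∨
            (RingHom.ker χ' ≠ ⊥ ∧ ∀ g : L', χ' g = 0 → g ∈ (maximalIdeal L') ^ 2)) := by
  intro n
  induction n with
  | zero =>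
    intro L _ _ _ _ ψ χ hχO hloc hψχ hle
    by_cases hst : ∀ g : L, χ g = 0 → g ∈ (maximalIdeal L) ^ 2
    · by_cases hker : RingHom.ker χ = ⊥
      · exact ⟨L, inferInstance, inferInstance, inferInstance, inferInstance, ψ, χ, hχO, hloc, hψχ,
          Or.inl ((RingHom.injective_iff_ker_eq_bot χ).mpr hker)⟩
      · exact ⟨L, inferInstance, inferInstance, inferInstance, inferInstance, ψ, χ, hχO, hloc, hψχ,
          Or.inr ⟨hker, hst⟩⟩
    · push Not at hst
      obtain ⟨g, hg, hg2⟩ := hst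
      obtain ⟨L', _, _, _, _, ψ', χ', -, -, -, hdim⟩ :=
        hslice k K O R L ψ χ hχO hloc hψχ g hg hg2
      omega
  | succ n ih =>
    intro L _ _ _ _ ψ χ hχO hloc hψχ hle
    by_cases hst : ∀ g : L, χ g = 0 → g ∈ (maximalIdeal L) ^ 2
    · by_cases hker : RingHom.ker χ = ⊥
      · exact ⟨L, inferInstance, inferInstance, inferInstance, inferInstance, ψ, χ, hχO, hloc, hψχ,
          Or.inl ((RingHom.injective_iff_ker_eq_bot χ).mpr hker)⟩
      · exact ⟨L, inferInstance, inferInstance, inferInstance, inferInstance, ψ, χ, hχO, hloc, hψχ,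
          Or.inr ⟨hker, hst⟩⟩
    · push Not at hst
      obtain ⟨g, hg, hg2⟩ := hst
      obtain ⟨L', _, _, _, _, ψ', χ', hχO', hloc', hψχ', hdim⟩ :=
        hslice k K O R L ψ χ hχO hloc hψχ g hg hg2
      exact ih L' ψ' χ' hχO' hloc' hψχ' (by omega)

/-! ## The composition (kernel-checked; no `sorry` in its own term) -/

/-- **`SmoothToUniformizing` from the five stub statements** — the assembly, PROVED. Fix `p`,
ind-smoothness at `p`, and `R ⊆ O ⊆ K` over a perfect `k`. Enlarge `R` by an affine model of `K`
inside `O` (so `Frac R = K`); ind-smoothness gives a smooth chart, `stub_localChart` a local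
regular chart, `injective_or_stuck` an injective or a stuck one. An injective chart is a model
(`stub_modelOfInjectiveChart`); a stuck chart yields, by the kernel `stub_stuckTowerStabilises`, a
level `B ⊇ R` with a retracting smooth chart, regular at the centre by `stub_retractRegular`, with
`Frac B = K` since `R ≤ B`. [cite: StacksProject, Tag 07GC] -/
theorem SmoothToUniformizing_of :
    Sig.stub_localChart → Sig.stub_sliceChart → Sig.stub_modelOfInjectiveChart →
      Sig.stub_stuckTowerStabilises → Sig.stub_retractRegular → SmoothToUniformizing := by
  intro h₁ h₂ h₃ h₅ h₆ p hp hind k K _ _ _ _ _ hK O hO R hR hRO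
  -- enlarge `R` by an affine model `A₀ ⊆ O` of `K`
  obtain ⟨A₀, hA₀O, hA₀fg, hA₀fr⟩ := exists_affineModel k K hK O hO
  set R₁ : Subalgebra k K := R ⊔ A₀ with hR₁
  have hR₁O : R₁.toSubring ≤ O.toSubring := by
    let Oalg : Subalgebra k K := { O.toSubring with algebraMap_mem' := hO }
    change R ⊔ A₀ ≤ Oalg
    exact sup_le (fun x hx => hRO hx) (fun x hx => hA₀O hx)
  have hR₁fg : R₁.FG := hR.sup hA₀fg
  have hR₁fr : IsFractionRing ↥R₁ K := isFractionRing_of_le le_sup_right hA₀fr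
  have hRR₁ : R ≤ R₁ := le_sup_left
  -- a smooth chart of `R₁`, localized, then the dichotomy
  obtain ⟨T, _, _, hT, ψ, χ, hχO, hψχ⟩ := hind k K hK O hO R₁ hR₁fg hR₁O
  haveI := hT
  obtain ⟨L, _, _, _, _, ψL, χL, hχLO, hlocL, hψχL⟩ := h₁ k K O R₁ T ψ χ hχO hψχ
  obtain ⟨L', _, _, _, _, ψ', χ', hχO', hloc', hψχ', hcases⟩ :=
    injective_or_stuck h₂ O R₁ _ L ψL χL hχLO hlocL hψχL le_rfl
  rcases hcases with hinj | ⟨hker, hstuck⟩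
  · -- injective chart: a model
    obtain ⟨A, hA, hR₁A, hAfg, hAfr, hreg⟩ :=
      h₃ k K O R₁ hR₁fg hR₁O hR₁fr L' ψ' χ' hχO' hloc' hψχ' hinj
    exact ⟨A, hA, hRR₁.trans hR₁A, hAfg, hAfr, hreg⟩
  · -- stuck chart: the kernel, then the retract lemma
    obtain ⟨B, hB, hR₁B, hBfg, T', _, _, hT', ψB, χB, hψχB, hrange⟩ :=
      h₅ p hp hind k K hK O hO R₁ hR₁fg hR₁O hR₁fr L' ψ' χ' hχO' hloc' hψχ' hker hstuck
    haveI := hT'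
    exact ⟨B, hB, hRR₁.trans hR₁B, hBfg, isFractionRing_of_le hR₁B hR₁fr,
      h₆ k K O B hB hBfg T' ψB χB hψχB hrange⟩

/-- **The crux `SmoothToUniformizing`, assembled from the registered stubs** (the only `sorry`s
in its closure are the stubs, none of its own). -/
theorem SmoothToUniformizing_proof : SmoothToUniformizing :=
  SmoothToUniformizing_of stub_localChart stub_sliceChart stub_modelOfInjectiveChart
    stub_stuckTowerStabilises stub_retractRegular

end Summit.ResolutionOfSingularities.ResolutionOfSingularities.Cruxes.SmoothToUniformizing.Lines.Birth

end
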